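import Summits.CriticalPhenomena.PercolationContinuityZ3.Theorems.PercNearOneGluingNoHeavyLowerTailThreePartitionGridOrOrMatching
import Summits.CriticalPhenomena.PercolationContinuityZ3.Theorems.PercNearOneGluingNoHeavyLowerTailThreePartitionCylinderHall
import HarnessLib.Audit

/-!
# `NoHeavyLowerTail` (crux stmt-CriticalPhenomena-4575), master-family hierarchy P3 (gen 36): UNTWISTED THREE-PARTITION POSITIVITY FOR TRIPLES WITH
# TWO DISJUNCTIONS — `threePartN 𝒰 𝒱 𝒲 ≥ 0` whenever two of the three up-sets are of the form `OR(P) = {S : S ∩ P ≠ ∅}`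

Support file (seat `prim-masterthm-p3`; `--supports stmt-CriticalPhenomena-4575`; memo
`run/shared/lean/prim/prim-masterthm/FROM-prim-masterthm-p3-g36-CYLINDER-SLACK.md` §9).  Consequences of `typedMatchable_orOr` (`…GridOrOrMatching`):
the grid-transport inequality `∑_{q∈𝒰} κ_{∅,OR P,OR Q}(q) ≥ 0` for every family `𝒰` closed upwards in the grid order (`sum_gtKernel_nonneg_orOr`), hence for
cylinders over up-sets, i.e. `threePartNT ∅ 𝒰 (OR P) (OR Q) ≥ 0` (`threePartNT_empty_orOr_nonneg`, via `threePartNT_eq_sum_filter` of `…CylinderHall`), the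
untwisted `threePartN 𝒰 (OR P) (OR Q) ≥ 0` (`threePartN_orOr_nonneg`), and by the slot symmetries of `N` the same with the two disjunctions in any two
slots (`threePartN_nonneg_of_two_or`).  In particular the 'triangle' sink `(OR{1,2}, OR{0,1}, OR{0,2})` of the pair-saturation normal form has `N ≥ 0`
by a structural (non-enumerative) proof.
HONEST LABEL: the untwisted slice `τ = ∅` of `ThreePartitionPositivityTwisted` on a class; the twisted slices, COMB-C3 and Sahi's `C₃` remain OPEN;
nothing bears on the (closed) crux. [this work]
-/

noncomputable section

open Finset
open scoped symmDiff Classical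

namespace Summit.CriticalPhenomena.PercolationContinuityZ3.Theorems.ThreePartition

variable {ι : Type*} [Fintype ι]

/-- **Grid transport for untwisted OR–OR instances**: `∑_{q∈𝒰} κ_{∅,OR P,OR Q}(q) ≥ 0` for every family `𝒰` of configurations closed upwards in
the grid order. [this work] -/
theorem sum_gtKernel_nonneg_orOr (P Q : Set ι) {𝒰 : Set (Set ι × Set ι)}
    (h𝒰 : ∀ q q' : Set ι × Set ι, q ∈ 𝒰 → q.1 ∆ (∅ : Set ι) ⊆ q'.1 ∆ ∅ → q'.2 ∆ (∅ : Set ι) ⊆ q.2 ∆ ∅ → q' ∈ 𝒰) :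
    0 ≤ ∑ q ∈ (cfgs ι).filter (fun q => q ∈ 𝒰), gtKernel (∅ : Set ι) (orFam P) (orFam Q) q :=
  sum_gtKernel_nonneg_of_gtMatchable (gtMatchable_orOr P Q) h𝒰

/-- **`N_∅(𝒰, OR P, OR Q) ≥ 0`** for every up-set `𝒰` (cylinders are closed upwards in the grid order). [this work] -/
theorem threePartNT_empty_orOr_nonneg {𝒰 : Set (Set ι)} (h𝒰 : IsUpperSet 𝒰) (P Q : Set ι) :
    0 ≤ threePartNT (∅ : Set ι) 𝒰 (orFam P) (orFam Q) := by
  rw [threePartNT_eq_sum_filter]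
  refine sum_gtKernel_nonneg_orOr P Q fun q q' hq h1 _ => ?_
  rw [mem_cyl] at hq ⊢
  exact h𝒰 h1 hq

/-- **Untwisted three-partition positivity for `(𝒰, OR P, OR Q)`**: `threePartN 𝒰 (OR P) (OR Q) ≥ 0` for every up-set `𝒰` and all `P, Q`. [this work] -/
theorem threePartN_orOr_nonneg {𝒰 : Set (Set ι)} (h𝒰 : IsUpperSet 𝒰) (P Q : Set ι) :
    0 ≤ threePartN 𝒰 (orFam P) (orFam Q) := by
  rw [← threePartNT_empty]
  exact threePartNT_empty_orOr_nonneg h𝒰 P Q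

/-- **Two disjunctions in any two slots**: `threePartN 𝒰 𝒱 𝒲 ≥ 0` whenever two of the three up-sets are disjunctions `OR(P)`, `OR(Q)`
(slot symmetry of `N`). [this work] -/
theorem threePartN_nonneg_of_two_or {𝒰 𝒱 𝒲 : Set (Set ι)} (h𝒰 : IsUpperSet 𝒰) (h𝒱 : IsUpperSet 𝒱) (h𝒲 : IsUpperSet 𝒲)
    (h : (∃ P Q : Set ι, 𝒱 = orFam P ∧ 𝒲 = orFam Q) ∨ (∃ P Q : Set ι, 𝒰 = orFam P ∧ 𝒲 = orFam Q) ∨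
      (∃ P Q : Set ι, 𝒰 = orFam P ∧ 𝒱 = orFam Q)) :
    0 ≤ threePartN 𝒰 𝒱 𝒲 := by
  rcases h with ⟨P, Q, rfl, rfl⟩ | ⟨P, Q, rfl, rfl⟩ | ⟨P, Q, rfl, rfl⟩
  · exact threePartN_orOr_nonneg h𝒰 P Q
  · rw [← threePartNT_empty, threePartNT_swap12, threePartNT_empty]
    exact threePartN_orOr_nonneg h𝒱 P Q
  · rw [← threePartNT_empty, threePartNT_swap23, threePartNT_swap12, threePartNT_empty]
    exact threePartN_orOr_nonneg h𝒲 P Q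

end Summit.CriticalPhenomena.PercolationContinuityZ3.Theorems.ThreePartition

end
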